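/-
Origin: expansion seat `planner-pub-hodgecm-mc-sanity-1-0`, handover #6 2026-08-18T19:25Z md5 cec47c075306 (NEW additive leaf, 193 l.; imports Sanity.PointwiseSanity (row 8) + Sanity.SexticNonVacuity (row 4) + HodgeCM.Model.EndStateLevelMeet = prl1-g11 E3 65a4a1915c67 (their kit row #2) as targeted; install after those) (`HOME/mc/pub-hodgecm-mc-sanity-1/lean/PointwiseRecord.lean`, md5 cec47c07, 193 lines);
landed by the packager successor (mc-unitary-1-g3, gen-8 kit) in gate run 32 as `HodgeCM/Model/Sanity/PointwiseRecord.lean` (verbatim).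
-/
/-
HodgeCM / MODEL-CONSTRUCTION sub-cell (pub-hodgecm), node SAN — construction prover `pub-hodgecm-mc-sanity-1`
(seat planner-pub-hodgecm-mc-sanity-1-0), 2026-08-18.  Intended PKG path: `HodgeCM/Model/Sanity/PointwiseRecord.lean`.
Imports `Sanity/PointwiseSanity.lean` (this seat; itself importing E2′ `Model/EndStatePerLAxioms.lean`, prl1-g11),
`Sanity/SexticNonVacuity.lean` (this seat) and the END-STATE owner's E3 leaf `Model/EndStateLevelMeet.lean` (prl1-g11, md5
65a4a1915c67: records `AllCharsNonDesignPt S` = E2″ and `AllCharsNonDesignPt₁ S` = E3, hypothesis `ThetaModelExists_sextic₁`,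
headline `Assembly.perL_ofSignRecipe₉`); nothing restated, no new axioms, no hypotheses records, 0 proof holes.
-/
import Summits.HodgeConjecture.HodgeCM.Model.Sanity.PointwiseSanity
import Summits.HodgeConjecture.HodgeCM.Model.Sanity.SexticNonVacuity
import Summits.HodgeConjecture.HodgeCM.Model.EndStateLevelMeet_2

/-!
# Sanity: the record-level no-go over the FIVE PerL model facts

`Sanity/KernelsLoadBearing.lean` proved `¬ AllCharsNonDesign` for zero-kernel cores over the 28 model facts
`M : U.ModelAxioms`; with E2′ in place the same holds over the five facts `M : U.ModelAxiomsPerL` of the PerL cone, as a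
corollary of the pointwise no-go `false_of_zeroKernelsAt` at ONE good context (which exists unconditionally:
`exists_signRecipe_goodCtx`, Landherr discharged in-package):

* `not_allCharsNonDesign_of_zeroKernels₅ (M : U.ModelAxiomsPerL) (hHR) (hθ : C.ZeroKernels) : ¬ AllCharsNonDesign`;
* `not_allCharsNonDesign_withDegenerateWM₅`;
* `exists_theta_ne_zero_of_allCharsNonDesign₅` — the non-degeneracy witness extracted from any global E2 witness;
* `exists_theta_ne_zero_at_of_local` — POINTWISE extraction: the local bodies `h₂ h₅ h₆ h₇` of E2′ at `(V, c)` already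
  give a nonzero theta kernel AT `(V, c)` (contrapositive of `false_of_zeroKernelsAt`; referee rule R2 at C).

§2, at the level of the END-STATE owner's pointwise records (prl1-g11 `EndStateLevelMeet.lean`): E2″ = `AllCharsNonDesignPt S`
(C1/C2 gated at good `S`-contexts) and E3 = `AllCharsNonDesignPt₁ S` (C1 replaced by LEVEL-MEETING `LevelMeetAt V c`):

* `ThetaModel.levelMeetAt_of_emb_eq_zero` — the new C1-replacement `LevelMeetAt V c` holds VACUOUSLY when `emb = 0` at the
  levels of `V` (its hypothesis `⟪Λ, Λ⟫ ≠ 0` never fires): like C1/C3/C5/C6/C7 it is degenerate-satisfiable, so under E3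
  the load stays on C2 + C4 + the kernels, exactly where `false_of_zeroKernelsAt` puts it;
* `not_allCharsNonDesignPt₁_of_zeroKernelsAt M hHR hc hSc hθ` (and `…Pt…`) — a core whose theta kernels vanish at ONE good
  `S`-context is never an E3 (resp. E2″) witness — the no-go does not use C1 at all;
* `not_allCharsNonDesignPt₁_sextic_of_zeroKernels`, `…_withDegenerateWM`, `Universe.not_thetaModelExists_sextic₁_witness_withDegenerateWM`
  — never a witness of the SEXTIC E3 hypothesis `ThetaModelExists_sextic₁` (a good sextic context exists unconditionally,
  `exists_signRecipe_goodCtx_sextic`): the `wm` slot stays load-bearing under the weakest end state of record;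
* `exists_theta_ne_zero_of_allCharsNonDesignPt₁` — non-degeneracy at any good `S`-context from an E3 witness.
-/

set_option autoImplicit false

noncomputable section

open HodgeCM HodgeCM.Universe
open scoped InnerProductSpace
open Literature.AlgebraicGeometry.Motives (HodgeStructure)
open Literature.AlgebraicGeometry.Motives.HodgeStructure (conj)

attribute [-instance] Quotient.instMeasurableSpace

namespace HodgeCM

namespace Universe.AdelicThetaCore

variable {U : Universe} {hP : PrintFact_unitaryCompact} (C : U.AdelicThetaCore hP) (h : Bool)
variable (d12 d34 : ∀ {L : CMField}, SeesawCtx L → SideData L)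

/-- **`¬ AllCharsNonDesign` for zero-kernel cores, over the FIVE PerL model facts** (cf. `KernelsLoadBearing` over 28). -/
theorem not_allCharsNonDesign_of_zeroKernels₅ (M : U.ModelAxiomsPerL) (hHR : U.Fact_hodgeRiemann20)
    (hθ : C.ZeroKernels) : ¬ (C.thetaModel h d12 d34).AllCharsNonDesign := by
  intro A
  obtain ⟨L, ι₁, V, c, hc⟩ := exists_signRecipe_goodCtx h C d12 d34
  have hc' : (C.thetaModel h d12 d34).GoodCtx ι₁ c := (C.thetaModel_goodCtx_iff h d12 d34 ι₁ c).mpr hc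
  exact false_of_zeroKernelsAt h d12 d34 M hHR (hθ V c) (fun Γ => A.innerEmb Γ) (A.thetaSub V c hc')
    (A.thetaWedge V c hc') (A.thetaGen12All V c hc')

/-- The degenerate core is never a global E2 witness over a universe with the five facts and HR(2,0). -/
theorem not_allCharsNonDesign_withDegenerateWM₅ (M : U.ModelAxiomsPerL) (hHR : U.Fact_hodgeRiemann20) :
    ¬ (C.withDegenerateWM.thetaModel h d12 d34).AllCharsNonDesign :=
  not_allCharsNonDesign_of_zeroKernels₅ _ h d12 d34 M hHR (C.withDegenerateWM_zeroKernels)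

/-- **Non-degeneracy witness from a global E2 witness, over the five facts.** -/
theorem exists_theta_ne_zero_of_allCharsNonDesign₅ (M : U.ModelAxiomsPerL) (hHR : U.Fact_hodgeRiemann20)
    (A : (C.thetaModel h d12 d34).AllCharsNonDesign) :
    ∃ (L : CMField) (ι₁ : L →+* ℂ) (V : HermSpace3 L ι₁) (c : SeesawCtx L) (Φ : (C.wm V c).SK) (p : _),
      (C.wm V c).θ Φ p ≠ 0 := by
  by_contra H
  refine not_allCharsNonDesign_of_zeroKernels₅ C h d12 d34 M hHR (fun V c Φ => DFunLike.ext _ _ fun p => ?_) A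
  by_contra hp
  exact H ⟨_, _, V, c, Φ, p, fun h0 => hp (by rw [h0]; rfl)⟩

section At

variable {C}
variable {L : CMField} {ι₁ : L →+* ℂ} {V : HermSpace3 L ι₁} {c : SeesawCtx L}

/-- **POINTWISE non-degeneracy witness (R2 at C)**: the local bodies `h₂ h₅ h₆ h₇` of E2′ at `(V, c)` force a nonzero
theta kernel of the core AT `(V, c)`. -/
theorem exists_theta_ne_zero_at_of_local (M : U.ModelAxiomsPerL) (hHR : U.Fact_hodgeRiemann20)
    (h₂ : ∀ Γ : Level V, ∃ a : ℂ, a ≠ 0 ∧ ∀ η η' : U.CohC (U.pms L ι₁ V Γ) 2,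
      η ∈ (U.hodge (U.pms L ι₁ V Γ) 2).F 2 → η' ∈ (U.hodge (U.pms L ι₁ V Γ) 2).F 2 →
      ⟪(C.thetaModel h d12 d34).emb Γ η', (C.thetaModel h d12 d34).emb Γ η⟫_ℂ =
        a * U.trC (U.pms L ι₁ V Γ) 4 (U.cup2C (U.pms L ι₁ V Γ) 2 η (conj η')))
    (h₅ : ∀ (i : Fin 4) (Γ : Level V), (C.thetaModel h d12 d34).Theta V c i Γ ⊆ U.Uiso Γ c.K (c.Ψ i) c.σ)
    (h₆ : ∃ Γ : Level V, ∃ ω₁ ∈ (C.thetaModel h d12 d34).Theta V c 0 Γ, ∃ ω₂ ∈ (C.thetaModel h d12 d34).Theta V c 1 Γ,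
      U.cup2C (U.pms L ι₁ V Γ) 1 ω₁ ω₂ ≠ 0)
    (h₇ : ∀ (Γ : Level V) (ω₁ ω₂ : U.CohC (U.pms L ι₁ V Γ) 1), ω₁ ∈ (C.thetaModel h d12 d34).Theta V c 0 Γ →
        ω₂ ∈ (C.thetaModel h d12 d34).Theta V c 1 Γ →
        (C.thetaModel h d12 d34).Λ Γ ω₁ ω₂ ∈ (Submodule.span ℂ
          {u : (C.thetaModel h d12 d34).HG L ι₁ V | ∃ (χ : ((C.thetaModel h d12 d34).t12 V c).X)
            (Φ : (C.thetaModel h d12 d34).SK V c), u = ((C.thetaModel h d12 d34).t12 V c).ϑ χ Φ}).topologicalClosure) :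
    ∃ (Φ : (C.wm V c).SK) (p : _), (C.wm V c).θ Φ p ≠ 0 := by
  by_contra H
  refine false_of_zeroKernelsAt h d12 d34 M hHR (fun Φ => DFunLike.ext _ _ fun p => ?_) h₂ h₅ h₆ h₇
  by_contra hp
  exact H ⟨Φ, p, fun h0 => hp (by rw [h0]; rfl)⟩

end At

/-! ## §2 The same at the level of the pointwise records of record: E2″ `AllCharsNonDesignPt`, E3 `AllCharsNonDesignPt₁` -/

end Universe.AdelicThetaCore

/-- **The C1-replacement `LevelMeetAt V c` of E3 is degenerate-satisfiable**: it holds vacuously as soon as `emb = 0` at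
the levels of `V` (then every `Λ_Γ = 0` and the hypothesis `⟪Λ, Λ⟫ ≠ 0` never fires). -/
theorem Universe.ThetaModel.levelMeetAt_of_emb_eq_zero {U : Universe} (T : U.ThetaModel) {L : CMField} {ι₁ : L →+* ℂ}
    (V : HermSpace3 L ι₁) (c : SeesawCtx L) (hE : ∀ Γ : Level V, T.emb Γ = 0) : T.LevelMeetAt V c := by
  intro Γ₁ Γ₂ ω₁ ω₂ ω₃ ω₄ _ _ _ _ hne
  exact absurd (by rw [T.Λ_apply Γ₁, hE Γ₁, LinearMap.zero_apply, inner_zero_right]) hne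

namespace Universe.AdelicThetaCore

section E3

variable {U : Universe} {hP : PrintFact_unitaryCompact} {C : U.AdelicThetaCore hP} (h : Bool)
variable (d12 d34 : ∀ {L : CMField}, SeesawCtx L → SideData L)
variable {S : ∀ {L : CMField}, SeesawCtx L → Prop}

/-- `LevelMeetAt` for the zero-embedding cores (any `wm`, `Theta`): vacuous. -/
theorem levelMeetAt_of_zeroEmb (he : C.ZeroEmb) {L : CMField} {ι₁ : L →+* ℂ} (V : HermSpace3 L ι₁) (c : SeesawCtx L) :
    (C.thetaModel h d12 d34).LevelMeetAt V c :=
  (C.thetaModel h d12 d34).levelMeetAt_of_emb_eq_zero V c fun Γ =>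
    LinearMap.ext fun η => by rw [C.thetaModel_emb h d12 d34, he Γ]; rfl

/-- **A core with vanishing theta kernels at ONE good `S`-context is never an E3 witness `AllCharsNonDesignPt₁ S`**
(the no-go uses C2 `innerEmb`, C3, C4, C5 at `(V, c)` — not the level-meeting field). -/
theorem not_allCharsNonDesignPt₁_of_zeroKernelsAt (M : U.ModelAxiomsPerL) (hHR : U.Fact_hodgeRiemann20)
    {L : CMField} {ι₁ : L →+* ℂ} {V : HermSpace3 L ι₁} {c : SeesawCtx L}
    (hc : (C.thetaModel h d12 d34).GoodCtx ι₁ c) (hSc : S c) (hθ : C.ZeroKernelsAt V c) :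
    ¬ (C.thetaModel h d12 d34).AllCharsNonDesignPt₁ S := fun A =>
  false_of_zeroKernelsAt h d12 d34 M hHR hθ (A.innerEmb V c hc hSc) (A.thetaSub V c hc hSc)
    (A.thetaWedge V c hc hSc) (A.thetaGen12All V c hc hSc)

/-- The same for the E2″ record `AllCharsNonDesignPt S`. -/
theorem not_allCharsNonDesignPt_of_zeroKernelsAt (M : U.ModelAxiomsPerL) (hHR : U.Fact_hodgeRiemann20)
    {L : CMField} {ι₁ : L →+* ℂ} {V : HermSpace3 L ι₁} {c : SeesawCtx L}
    (hc : (C.thetaModel h d12 d34).GoodCtx ι₁ c) (hSc : S c) (hθ : C.ZeroKernelsAt V c) :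
    ¬ (C.thetaModel h d12 d34).AllCharsNonDesignPt S := fun A =>
  false_of_zeroKernelsAt h d12 d34 M hHR hθ (A.innerEmb V c hc hSc) (A.thetaSub V c hc hSc)
    (A.thetaWedge V c hc hSc) (A.thetaGen12All V c hc hSc)

variable (C)

/-- **Zero-kernel cores are never witnesses of the SEXTIC-restricted E3 record** (a good sextic context exists). -/
theorem not_allCharsNonDesignPt₁_sextic_of_zeroKernels (M : U.ModelAxiomsPerL) (hHR : U.Fact_hodgeRiemann20)
    (hθ : C.ZeroKernels) :
    ¬ (C.thetaModel h d12 d34).AllCharsNonDesignPt₁ (fun c => Module.finrank ℚ c.K = 6) := by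
  obtain ⟨L, ι₁, V, c, hc, h6⟩ := exists_signRecipe_goodCtx_sextic (h := h) C d12 d34
  exact not_allCharsNonDesignPt₁_of_zeroKernelsAt h d12 d34 M hHR
    ((C.thetaModel_goodCtx_iff h d12 d34 ι₁ c).mpr hc) h6 ((C.zeroKernels_iff_forall_at).mp hθ V c)

/-- In particular for the degenerate placeholder core `withDegenerateWM` (any `emb`, `cover`, `Theta`). -/
theorem not_allCharsNonDesignPt₁_sextic_withDegenerateWM (M : U.ModelAxiomsPerL) (hHR : U.Fact_hodgeRiemann20) :
    ¬ (C.withDegenerateWM.thetaModel h d12 d34).AllCharsNonDesignPt₁ (fun c => Module.finrank ℚ c.K = 6) :=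
  not_allCharsNonDesignPt₁_sextic_of_zeroKernels _ h d12 d34 M hHR (C.withDegenerateWM_zeroKernels)

/-- **Non-degeneracy from an E3 witness**: an `AllCharsNonDesignPt₁ S` witness has a nonzero theta kernel at EVERY good
`S`-context `(V, c)`. -/
theorem exists_theta_ne_zero_of_allCharsNonDesignPt₁ (M : U.ModelAxiomsPerL) (hHR : U.Fact_hodgeRiemann20)
    (A : (C.thetaModel h d12 d34).AllCharsNonDesignPt₁ S)
    {L : CMField} {ι₁ : L →+* ℂ} (V : HermSpace3 L ι₁) (c : SeesawCtx L)
    (hc : (C.thetaModel h d12 d34).GoodCtx ι₁ c) (hSc : S c) :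
    ∃ (Φ : (C.wm V c).SK) (p : _), (C.wm V c).θ Φ p ≠ 0 :=
  exists_theta_ne_zero_at_of_local h d12 d34 M hHR (A.innerEmb V c hc hSc) (A.thetaSub V c hc hSc)
    (A.thetaWedge V c hc hSc) (A.thetaGen12All V c hc hSc)

end E3

end Universe.AdelicThetaCore

/-- **The degenerate core is not a witness of the sextic E3 hypothesis `ThetaModelExists_sextic₁` in the `wm` slot**:
for `C : AdelicThetaCore₀` and any side data, `(C.withDegenerateWM.thetaModel h d12 d34).AllCharsNonDesignPt₁ sextic` fails
(so `⟨h, C.withDegenerateWM, d12, d34, _⟩` is never the anonymous-constructor term of `ThetaModelExists_sextic₁`). -/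
theorem Universe.not_thetaModelExists_sextic₁_witness_withDegenerateWM {U : Universe} (M : U.ModelAxiomsPerL)
    (hHR : U.Fact_hodgeRiemann20) (h : Bool) (C : U.AdelicThetaCore₀)
    (d12 d34 : ∀ {L : CMField}, SeesawCtx L → SideData L) :
    ¬ (C.withDegenerateWM.thetaModel h d12 d34).AllCharsNonDesignPt₁ (fun c => Module.finrank ℚ c.K = 6) :=
  Universe.AdelicThetaCore.not_allCharsNonDesignPt₁_sextic_withDegenerateWM C h d12 d34 M hHR

end HodgeCM

end
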